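import Summits.ResolutionOfSingularities.ResolutionOfSingularities.Theorems.EquisingularLiftEquisingularLiftNatQuasiRegularSpan
import Summits.ResolutionOfSingularities.ResolutionOfSingularities.Theorems.EquisingularLiftEquisingularLiftNatIdealSheafSpread
import Literature.AlgebraicGeometry.Modules.UnitCocycle
import HarnessLib

/-!
# [OURS · L1 W4.5b · T-DIRLIFT-UP route C, brick B5 of C1c] Direction coordinates on a downstairs chart

Cell res-hironaka, LADDER-RESOLUTION rung L, slot W4.5(b), crux chain w45b (EL♮(3) = stmt-ResolutionOfSingularities-20148); object
T-DIRLIFT-UP (res-L1-w45b-plan-1 RULING 19:14:55Z, route C), brick C1c (`L/res-D-pv-051/TARGET-C1c.sig.lean` b928b225abc4a457), sub-brick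
B5 (ideal side, per point). `--supports stmt-ResolutionOfSingularities-20148 --as helper`. THEOREMS ONLY; def-free; NOT a statement of any
manuscript; AI-written, AI review weaker than expert review.

WHAT. `G₀` locally Noetherian, `Ī`, `𝒟'` ideal sheaves, `W₀ ∋ y` an affine open on which `Ī(W₀) = (ℓ₀, ℓ₁)` (the chart generators
`ℓ_j = j₀♯ x_j` of the trace ideal), `y ∈ Supp Ī` a point where `𝒟'` is a DIRECTION (`𝒟'_y = (c′₀) + (c′₁²)` for some quasi-regular frame
`c′` of `Ī_y`, the `hdir'` clause). THEN (`exists_direction_coords_on_chart`) on some affine `W ⊆ W₀` around `y` there are coefficients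
`α = (α₀, α₁)` and `a = (a₀, a₁)` with `a₀α₀ + a₁α₁ − 1 ∈ Ī(W)` (unimodular mod `Ī`) and `𝒟'(W) = (α₀ℓ₀ + α₁ℓ₁) + Ī(W)²`.
Steps: the chart germs `(ℓ₀,ℓ₁)_y` are quasi-regular (B1 `isQuasiRegular_of_span_eq`, p565463); direction coordinates at the stalk (ring
core `exists_unimodular_coords_of_direction`, p561783); germs ↦ sections, membership and the stalk presentation spread to basic opens (B6,
`…NatIdealSheafSpread`). This is the coefficient half of the DICTIONARY clause of C1c.
-/

noncomputable section

open CategoryTheory AlgebraicGeometry Opposite TopologicalSpace IsLocalRing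
open Literature.AlgebraicGeometry.Resolution Literature.AlgebraicGeometry.Modules

set_option linter.dupNamespace false -- mandated namespace `Summit.<Summit>.<Problem>` of this single-conjunct summit

namespace Summit.ResolutionOfSingularities.ResolutionOfSingularities.Cruxes.EquisingularLiftNat.Sections

universe u

variable {G₀ : Scheme.{u}}

/-- Germs of restricted sections. [folklore] -/
theorem germ_secRes {V V' : G₀.Opens} (i : V' ≤ V) {y : G₀} (hy : y ∈ V') (a : Γ(G₀, V)) :
    (G₀.presheaf.germ V' y hy).hom (secRes G₀ i a) = (G₀.presheaf.germ V y (i hy)).hom a :=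
  TopCat.Presheaf.germ_res_apply G₀.presheaf (homOfLE i) y hy a

/-- Restriction of ideal-sheaf sections along affine opens `W ≤ V`: `Ī(V)·Γ(W) = Ī(W)`, `secRes` form. [folklore] -/
theorem map_secRes_ideal (Ī : G₀.IdealSheafData) {V W : G₀.affineOpens} (h : (W : G₀.Opens) ≤ V) :
    (Ī.ideal V).map (secRes G₀ h) = Ī.ideal W :=
  Ī.map_ideal h

/-- **Direction coordinates on a downstairs chart (B5).** See the module docstring. [OURS · planning text of w45b route C] -/
theorem exists_direction_coords_on_chart [IsLocallyNoetherian G₀] (Ī 𝒟' : G₀.IdealSheafData)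
    (W₀ : G₀.affineOpens) {y : G₀} (hy : y ∈ (W₀ : G₀.Opens)) (hyS : y ∈ Ī.support)
    (ℓ : Fin 2 → Γ(G₀, W₀)) (hℓ : Ī.ideal W₀ = Ideal.span (Set.range ℓ))
    (hdir : ∃ c : Fin 2 → G₀.presheaf.stalk y, Ideal.span (Set.range c) = stalkIdeal Ī y ∧ IsQuasiRegular c ∧
      stalkIdeal 𝒟' y = Ideal.span {c 0} ⊔ Ideal.span {c 1 * c 1}) :
    ∃ (W : G₀.affineOpens) (hW : (W : G₀.Opens) ≤ W₀) (_ : y ∈ (W : G₀.Opens)) (α a : Fin 2 → Γ(G₀, W)),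
      (∑ j, a j * α j - 1) ∈ Ī.ideal W ∧
      𝒟'.ideal W = Ideal.span {∑ j, α j * secRes G₀ hW (ℓ j)} ⊔ (Ī.ideal W) ^ 2 := by
  classical
  obtain ⟨c', hc'span, hc'qr, hD⟩ := hdir
  -- the chart germs `c = (ℓ₀, ℓ₁)_y` generate `Ī_y` and are quasi-regular
  set c : Fin 2 → G₀.presheaf.stalk y := fun j => (G₀.presheaf.germ W₀ y hy).hom (ℓ j) with hc
  have hcspan : Ideal.span (Set.range c) = stalkIdeal Ī y := by
    rw [stalkIdeal_eq_map_germ Ī W₀ hy, hℓ, Ideal.map_span, ← Set.range_comp]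
    rfl
  have h𝔪 : Ideal.span (Set.range c') ≤ maximalIdeal (G₀.presheaf.stalk y) := by
    rw [hc'span]; exact (mem_support_iff_stalkIdeal_le Ī y).mp hyS
  have hcqr : IsQuasiRegular c := isQuasiRegular_of_span_eq hc'qr h𝔪 (hcspan.trans hc'span.symm)
  -- direction coordinates at the stalk
  obtain ⟨α₀, β₀, hD', x₀, y₀, hu⟩ := exists_unimodular_coords_of_direction hcqr c' (hc'span.trans hcspan.symm) hD
  -- Step A: the four germs are sections over a basic open `W₁ ∋ y` of `W₀`
  obtain ⟨r₁, hyr₁, s, hs⟩ := exists_basicOpen_sections_of_germs W₀ hy ![α₀, β₀, x₀, y₀]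
  have hs0 : (G₀.presheaf.germ (G₀.affineBasicOpen r₁) y hyr₁).hom (s 0) = α₀ := by rw [hs 0]; rfl
  have hs1 : (G₀.presheaf.germ (G₀.affineBasicOpen r₁) y hyr₁).hom (s 1) = β₀ := by rw [hs 1]; rfl
  have hs2 : (G₀.presheaf.germ (G₀.affineBasicOpen r₁) y hyr₁).hom (s 2) = x₀ := by rw [hs 2]; rfl
  have hs3 : (G₀.presheaf.germ (G₀.affineBasicOpen r₁) y hyr₁).hom (s 3) = y₀ := by rw [hs 3]; rfl
  have hW₁ : (G₀.affineBasicOpen r₁ : G₀.Opens) ≤ W₀ := G₀.basicOpen_le r₁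
  -- Step B: unimodularity holds in `Ī(W₂)` on a basic open `W₂ ∋ y` of `W₁`
  obtain ⟨r₂, hyr₂, hmem⟩ := exists_basicOpen_res_mem_ideal Ī (G₀.affineBasicOpen r₁) hyr₁ (s 2 * s 0 + s 3 * s 1 - 1) (by
    rw [map_sub, map_add, map_mul, map_mul, map_one, hs0, hs1, hs2, hs3, ← hcspan]
    exact hu)
  have hW₂ : (G₀.affineBasicOpen r₂ : G₀.Opens) ≤ G₀.affineBasicOpen r₁ := G₀.basicOpen_le r₂
  -- Step C: the stalk presentation `𝒟'_y = (v_y) + Ī_y²` spreads to a basic open `W ∋ y` of `W₂`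
  set v : Γ(G₀, G₀.affineBasicOpen r₂) :=
    secRes G₀ hW₂ (s 0) * secRes G₀ (hW₂.trans hW₁) (ℓ 0) + secRes G₀ hW₂ (s 1) * secRes G₀ (hW₂.trans hW₁) (ℓ 1) with hv
  have hK : stalkIdeal 𝒟' y = (Ideal.span {v} ⊔ Ī.ideal (G₀.affineBasicOpen r₂) ^ 2).map
      (G₀.presheaf.germ (G₀.affineBasicOpen r₂) y hyr₂).hom := by
    rw [Ideal.map_sup, Ideal.map_pow, Ideal.map_span, Set.image_singleton, ← stalkIdeal_eq_map_germ Ī _ hyr₂, ← hcspan, hD']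
    congr 2
    rw [hv, map_add, map_mul, map_mul, germ_secRes, germ_secRes, germ_secRes, germ_secRes, hs0, hs1]
  obtain ⟨r₃, hyr₃, h𝒟⟩ := exists_basicOpen_ideal_eq_map 𝒟' (G₀.affineBasicOpen r₂) hyr₂ _ hK
  have hW₃ : (G₀.affineBasicOpen r₃ : G₀.Opens) ≤ G₀.affineBasicOpen r₂ := G₀.basicOpen_le r₃
  -- the output chart
  refine ⟨G₀.affineBasicOpen r₃, hW₃.trans (hW₂.trans hW₁), hyr₃,
    ![secRes G₀ (hW₃.trans hW₂) (s 0), secRes G₀ (hW₃.trans hW₂) (s 1)],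
    ![secRes G₀ (hW₃.trans hW₂) (s 2), secRes G₀ (hW₃.trans hW₂) (s 3)], ?_, ?_⟩
  · -- unimodularity restricted to `W`
    have h := Ideal.mem_map_of_mem (secRes G₀ hW₃) hmem
    rw [map_secRes_ideal Ī hW₃] at h
    have e : ∑ j, ![secRes G₀ (hW₃.trans hW₂) (s 2), secRes G₀ (hW₃.trans hW₂) (s 3)] j *
        ![secRes G₀ (hW₃.trans hW₂) (s 0), secRes G₀ (hW₃.trans hW₂) (s 1)] j - 1 =
        secRes G₀ hW₃ (secRes G₀ hW₂ (s 2 * s 0 + s 3 * s 1 - 1)) := by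
      rw [Fin.sum_univ_two, secRes_secRes, map_sub, map_add, map_mul, map_mul, map_one]
      rfl
    rw [e]
    exact h
  · -- the presentation restricted to `W`
    rw [h𝒟, Ideal.map_sup, Ideal.map_pow, Ideal.map_span, Set.image_singleton]
    change Ideal.span {secRes G₀ hW₃ v} ⊔ (Ī.ideal (G₀.affineBasicOpen r₂)).map (secRes G₀ hW₃) ^ 2 = _
    rw [map_secRes_ideal Ī hW₃]
    congr 2
    rw [hv, Fin.sum_univ_two, map_add, map_mul, map_mul, secRes_secRes, secRes_secRes, secRes_secRes, secRes_secRes]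
    rfl

end Summit.ResolutionOfSingularities.ResolutionOfSingularities.Cruxes.EquisingularLiftNat.Sections

end
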